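import Mathlib
import HarnessLib.Audit
import Summits.PneNP.PneNP.Theorems.PstarMenuCriterion
import Summits.PneNP.PneNP.Theorems.PstarCleanBridge

/-!
# The skeleton of an XOR-connected terminal core has at least as many members as the core has XOR vertices (ROUND-24, O1; all core sizes; memo g25 §43)

FRONTIER range-avoidance ladder, rung F-N3, ROUND 24 (cell `pnp-ideate`, prover-2 memo `g25/O1-XORSPLIT-g25.md` §43, planner memo
`r24/CORE-BOUND-NOTES.md` §14.59 (A); typed targets `PstarCoreBoundTargets.TerminalFive` / `TerminalPeelable` (p646951); restricted-model proof
complexity — nothing here bears on `P` versus `NP`).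

The SKELETON of a core `K` (menu `M`) is the set of its members that are NOT outside-gated chords: the non-chords and the dirty chords.  Inside the
core-bound induction (proper terminal sub-cores have at most five members) no clean cut of a terminal core is crossed
(`PstarCleanBridge.false_of_clean_bridge`, `PstarCleanCutAssembly.false_of_cleanCut_two`) and every XOR vertex lies on a skeleton member
(`PstarNoFreeVertex.covered_of_terminal`).  This file turns these into the counting statement used by the planner's all-`k` pencil theorem:

* `card_xverts_le_card` (pure combinatorics): a family `E` that is X-CONNECTED (every proper non-empty set of its XOR vertices is crossed by a
  member) and contains a non-empty leafless subfamily has at least as many members as XOR vertices (leaf-stripping induction + handshake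
  `PstarChordBridgeFundamental.sum_xpdeg`).
* `xconnected_skel`: inside the induction, the skeleton of an X-connected terminal core is X-connected on ALL the XOR vertices of the core.
* **`card_xverts_le_card_skel`**: hence an X-connected terminal core with a centre has `#xverts K ≤ #skeleton = #nonchords + #dirty chords`, and
  **`card_xverts_add_le`**: `#xverts K + 3·#K ≤ #sharedSlots K + 2·#bdry K` (non-chords `≤ #sharedSlots`, `PstarCleanChordCount`; dirty chords
  `≤` the boundary slack, `PstarChordReadTwoCleanCount.card_dirty_le_slack`).  For the tight twelve-slot structures (`#bdry = 2k − 6`,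
  `#sharedSlots = 6`) this reads `u ≤ k − 6`, i.e. `t = k − 12 ≥ u − 6` — part (A) of the planner's pencil theorem §14.59, now in the kernel.
-/

set_option linter.dupNamespace false -- `Summit.PneNP.PneNP.…`: summit = sub-problem name (D-0017 single-conjunct layout)

open Finset Literature.Computability.Complexity
open Summit.PneNP.PneNP.Theorems.PstarTyped (Typed)
open Summit.PneNP.PneNP.Theorems.PstarSALevel (varSet bdry BoundaryExpanding SimpleOverlap)
open Summit.PneNP.PneNP.Theorems.PstarXCore (xpair mem_xpair xverts)
open Summit.PneNP.PneNP.Theorems.PstarXorElimination (pdeg)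
open Summit.PneNP.PneNP.Theorems.PstarCoreBound (XorClosed)
open Summit.PneNP.PneNP.Theorems.PstarChordRepair (IsChord)
open Summit.PneNP.PneNP.Theorems.PstarCoreBoundTargets (Terminal nonchords mem_nonchords)
open Summit.PneNP.PneNP.Theorems.PstarSharingBound (sharedSlots)
open Summit.PneNP.PneNP.Theorems.PstarChordBridgeTools (xpdeg)
open Summit.PneNP.PneNP.Theorems.PstarChordBridgeCotree (exists_leaf_edge)
open Summit.PneNP.PneNP.Theorems.PstarChordBridgeFundamental (sum_xpdeg)
open Summit.PneNP.PneNP.Theorems.PstarChordBridgeExchange (mem_xverts_iff)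
open Summit.PneNP.PneNP.Theorems.PstarChordReadOutside (OutsideGated)
open Summit.PneNP.PneNP.Theorems.PstarChordReadTwoCleanCount (card_dirty_le_slack)
open Summit.PneNP.PneNP.Theorems.PstarCleanChordCount (card_nonchords_le_card_sharedSlots)
open Summit.PneNP.PneNP.Theorems.PstarNoFreeVertex (covered_of_terminal vars_mem_xpair)
open Summit.PneNP.PneNP.Theorems.PstarCleanCut (Crosses CleanCut)
open Summit.PneNP.PneNP.Theorems.PstarCleanCutAssembly (false_of_cleanCut_two)
open Summit.PneNP.PneNP.Theorems.PstarCleanBridge (not_unique_crossing)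
open Summit.PneNP.PneNP.Theorems.PstarNorUnitAssembly (xpdeg_singleton_of_mem)

namespace Summit.PneNP.PneNP.Theorems.PstarSkeletonSpan

variable {n m : ℕ}

/-! ## X-connected families and the skeleton -/

/-- **X-CONNECTED family**: every non-empty proper subset of the XOR vertices of `E` is crossed by a member of `E` (the XOR graph of `E` is
connected on its vertex set). -/
def XConnected (I : LocalMap 4 n m) (E : Finset (Fin m)) : Prop :=
  ∀ W ⊆ xverts I E, W.Nonempty → W ≠ xverts I E → ∃ f ∈ E, Crosses I W f

open Classical in
/-- The SKELETON of `K` for the menu `M`: the members that are not outside-gated chords (non-chords and dirty chords). -/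
noncomputable def skel (I : LocalMap 4 n m) (K M : Finset (Fin m)) : Finset (Fin m) :=
  K.filter fun f => ¬ (IsChord I K f ∧ OutsideGated I K M f)

/-- Membership in the skeleton. -/
theorem mem_skel (I : LocalMap 4 n m) {K M : Finset (Fin m)} {f : Fin m} :
    f ∈ skel I K M ↔ f ∈ K ∧ ¬ (IsChord I K f ∧ OutsideGated I K M f) := by
  classical
  unfold skel; rw [mem_filter]

/-- `skel ⊆ K`. -/
theorem skel_subset (I : LocalMap 4 n m) (K M : Finset (Fin m)) : skel I K M ⊆ K := by
  classical
  unfold skel; exact filter_subset _ _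

/-- Slot-degree is monotone in the family. -/
theorem xpdeg_mono (I : LocalMap 4 n m) {S E : Finset (Fin m)} (h : S ⊆ E) (w : Fin n) : xpdeg I S w ≤ xpdeg I E w := by
  classical
  unfold PstarChordBridgeTools.xpdeg PstarXorElimination.pdeg
  exact Nat.add_le_add (card_le_card (filter_subset_filter _ h)) (card_le_card (filter_subset_filter _ h))

/-- A vertex of `E` has positive slot-degree. -/
theorem xpdeg_pos_of_mem_xverts (I : LocalMap 4 n m) (hI : I.IsPure xorAndPred) {E : Finset (Fin m)} {w : Fin n} (hw : w ∈ xverts I E) :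
    0 < xpdeg I E w := by
  obtain ⟨j, hj, hwj⟩ := (mem_xverts_iff I E w).1 hw
  have h1 := xpdeg_singleton_of_mem I hI hwj
  have h2 := xpdeg_mono I (singleton_subset_iff.2 hj) w
  omega

/-- `xverts` is monotone. -/
theorem xverts_mono (I : LocalMap 4 n m) {S E : Finset (Fin m)} (h : S ⊆ E) : xverts I S ⊆ xverts I E := by
  intro v hv
  obtain ⟨j, hj, hvj⟩ := (mem_xverts_iff I S v).1 hv
  exact (mem_xverts_iff I E v).2 ⟨j, h hj, hvj⟩

/-! ## Members ≥ vertices for X-connected families with a leafless part -/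

/-- **EDGE–VERTEX INEQUALITY.**  An X-connected family containing a non-empty leafless subfamily has at least as many members as XOR vertices.
(Strip a leaf vertex with its unique member and recurse — X-connectedness keeps the other endpoint alive and survives; with no leaf every vertex
has slot-degree `≥ 2` and the handshake gives `2·#xverts ≤ 2·#E`.) -/
theorem card_xverts_le_card (I : LocalMap 4 n m) (hI : I.IsPure xorAndPred) :
    ∀ E : Finset (Fin m), XConnected I E → (∃ S ⊆ E, S.Nonempty ∧ ∀ w ∈ xverts I S, 2 ≤ xpdeg I S w) → (xverts I E).card ≤ E.card := by
  classical
  suffices H : ∀ (k : ℕ) (E : Finset (Fin m)), E.card = k → XConnected I E →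
      (∃ S ⊆ E, S.Nonempty ∧ ∀ w ∈ xverts I S, 2 ≤ xpdeg I S w) → (xverts I E).card ≤ E.card from fun E => H _ E rfl
  intro k
  induction k using Nat.strong_induction_on with
  | _ k ih =>
    intro E hk hconn hcyc
    obtain ⟨S, hSE, hSne, hSL⟩ := hcyc
    have h01 : ∀ j : Fin m, I.vars j 0 ≠ I.vars j 1 := fun j h => absurd (hI.2 j h) (by decide)
    by_cases hleaf : ∃ w ∈ xverts I E, xpdeg I E w = 1
    · -- strip a leaf
      obtain ⟨w, hw, hdeg⟩ := hleaf
      obtain ⟨e, he, hwe, huniq⟩ := exists_leaf_edge I hdeg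
      have heS : e ∉ S := by
        intro heS
        have h2 := hSL w ((mem_xverts_iff I S w).2 ⟨e, heS, hwe⟩)
        have := xpdeg_mono I hSE w
        omega
      set E' := E.erase e with hE'
      have hE'E : E' ⊆ E := erase_subset e E
      have hwE' : w ∉ xverts I E' := by
        intro h
        obtain ⟨j, hj, hwj⟩ := (mem_xverts_iff I E' w).1 h
        exact (mem_erase.1 hj).1 (huniq j (mem_of_mem_erase hj) hwj)
      -- the other endpoint `w'` of `e`
      obtain ⟨w', hw'e, hww'⟩ : ∃ w', w' ∈ xpair I e ∧ w' ≠ w := by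
        rcases (mem_xpair I).1 hwe with h | h
        · exact ⟨I.vars e 1, (mem_xpair I).2 (Or.inr rfl), fun h' => h01 e (h ▸ h'.symm)⟩
        · exact ⟨I.vars e 0, (mem_xpair I).2 (Or.inl rfl), fun h' => h01 e (h'.trans h)⟩
      have hpair : ∀ v ∈ xpair I e, v = w ∨ v = w' := by
        intro v hv
        rcases (mem_xpair I).1 hwe with hw0 | hw1 <;> rcases (mem_xpair I).1 hw'e with hw'0 | hw'1 <;>
          rcases (mem_xpair I).1 hv with hv0 | hv1
        · exact absurd (hw'0.trans hw0.symm) hww'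
        · exact absurd (hw'0.trans hw0.symm) hww'
        · exact Or.inl (hv0.trans hw0.symm)
        · exact Or.inr (hv1.trans hw'1.symm)
        · exact Or.inr (hv0.trans hw'0.symm)
        · exact Or.inl (hv1.trans hw1.symm)
        · exact absurd (hw'1.trans hw1.symm) hww'
        · exact absurd (hw'1.trans hw1.symm) hww'
      -- `w'` survives in `E'`: the cut `{w, w'}` is crossed by a member other than `e`
      have hw'E' : w' ∈ xverts I E' := by
        have hWsub : ({w, w'} : Finset (Fin n)) ⊆ xverts I E := by
          intro v hv
          rcases mem_insert.1 hv with rfl | hv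
          · exact hw
          · rw [mem_singleton.1 hv]; exact (mem_xverts_iff I E _).2 ⟨e, he, hw'e⟩
        have hWne : ({w, w'} : Finset (Fin n)) ≠ xverts I E := by
          intro hW
          -- then every member of `S` has XOR pair `{w, w'}`, so `w` has `S`-degree `#S ≥ 2`: not a leaf of `E`
          obtain ⟨s, hs⟩ := hSne
          have hsw : w ∈ xpair I s := by
            have h0 : I.vars s 0 ∈ ({w, w'} : Finset (Fin n)) := hW ▸ (mem_xverts_iff I E _).2 ⟨s, hSE hs, (mem_xpair I).2 (Or.inl rfl)⟩
            have h1 : I.vars s 1 ∈ ({w, w'} : Finset (Fin n)) := hW ▸ (mem_xverts_iff I E _).2 ⟨s, hSE hs, (mem_xpair I).2 (Or.inr rfl)⟩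
            rw [mem_insert, mem_singleton] at h0 h1
            rcases h0 with h0 | h0
            · exact (mem_xpair I).2 (Or.inl h0.symm)
            · rcases h1 with h1 | h1
              · exact (mem_xpair I).2 (Or.inr h1.symm)
              · exact absurd (h0.trans h1.symm) (h01 s)
          have h2 := hSL w ((mem_xverts_iff I S w).2 ⟨s, hs, hsw⟩)
          have := xpdeg_mono I hSE w
          omega
        obtain ⟨f, hf, hcr⟩ := hconn {w, w'} hWsub ⟨w, mem_insert_self _ _⟩ hWne
        have hfe : f ≠ e := by
          rintro rfl
          rcases hcr with ⟨h0, h1⟩ | ⟨h0, h1⟩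
          · exact h1 (by rcases hpair _ ((mem_xpair I).2 (Or.inr rfl)) with h | h <;> simp [h])
          · exact h0 (by rcases hpair _ ((mem_xpair I).2 (Or.inl rfl)) with h | h <;> simp [h])
        have hfE' : f ∈ E' := mem_erase.2 ⟨hfe, hf⟩
        have hfw : w ∉ xpair I f := fun h => hfe (huniq f hf h)
        rcases hcr with ⟨h0, -⟩ | ⟨-, h1⟩
        · rw [mem_insert, mem_singleton] at h0
          rcases h0 with h0 | h0
          · exact absurd ((mem_xpair I).2 (Or.inl h0.symm)) hfw
          · exact (mem_xverts_iff I E' _).2 ⟨f, hfE', (mem_xpair I).2 (Or.inl h0.symm)⟩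
        · rw [mem_insert, mem_singleton] at h1
          rcases h1 with h1 | h1
          · exact absurd ((mem_xpair I).2 (Or.inr h1.symm)) hfw
          · exact (mem_xverts_iff I E' _).2 ⟨f, hfE', (mem_xpair I).2 (Or.inr h1.symm)⟩
      -- vertices: `xverts E ⊆ insert w (xverts E')`
      have hV : xverts I E ⊆ insert w (xverts I E') := by
        intro v hv
        obtain ⟨j, hj, hvj⟩ := (mem_xverts_iff I E v).1 hv
        by_cases hje : j = e
        · subst hje
          rcases hpair v hvj with rfl | rfl
          · exact mem_insert_self _ _
          · exact mem_insert_of_mem hw'E'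
        · exact mem_insert_of_mem ((mem_xverts_iff I E' v).2 ⟨j, mem_erase.2 ⟨hje, hj⟩, hvj⟩)
      -- `E'` is X-connected
      have hconn' : XConnected I E' := by
        intro W' hW'sub hW'ne hW'neq
        set W : Finset (Fin n) := if w' ∈ W' then insert w W' else W' with hWdef
        have hWsub : W ⊆ xverts I E := by
          intro v hv
          rw [hWdef] at hv
          by_cases hw'W : w' ∈ W'
          · rw [if_pos hw'W, mem_insert] at hv
            rcases hv with rfl | hv
            · exact hw
            · exact xverts_mono I hE'E (hW'sub hv)
          · rw [if_neg hw'W] at hv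
            exact xverts_mono I hE'E (hW'sub hv)
        have hWne : W.Nonempty := by
          obtain ⟨v, hv⟩ := hW'ne
          refine ⟨v, ?_⟩
          rw [hWdef]
          by_cases hw'W : w' ∈ W'
          · rw [if_pos hw'W]; exact mem_insert_of_mem hv
          · rw [if_neg hw'W]; exact hv
        have hWneq : W ≠ xverts I E := by
          intro hWE
          rw [hWdef] at hWE
          by_cases hw'W : w' ∈ W'
          · rw [if_pos hw'W] at hWE
            apply hW'neq
            refine Subset.antisymm hW'sub fun v hv => ?_
            have hv' : v ∈ insert w W' := hWE ▸ xverts_mono I hE'E hv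
            rcases mem_insert.1 hv' with rfl | h
            · exact absurd hv hwE'
            · exact h
          · rw [if_neg hw'W] at hWE
            exact hwE' (hW'sub (hWE ▸ hw))
        obtain ⟨f, hf, hcr⟩ := hconn W hWsub hWne hWneq
        -- `f ≠ e`: both endpoints of `e` are on the same side of `W`
        have memW : ∀ v, v ≠ w → (v ∈ W ↔ v ∈ W') := by
          intro v hvw
          rw [hWdef]
          by_cases hw'W : w' ∈ W'
          · rw [if_pos hw'W, mem_insert]
            exact ⟨fun h => h.resolve_left hvw, Or.inr⟩
          · rw [if_neg hw'W]
        have hwW : w ∈ W ↔ w' ∈ W' := by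
          rw [hWdef]
          by_cases hw'W : w' ∈ W'
          · rw [if_pos hw'W]; exact ⟨fun _ => hw'W, fun _ => mem_insert_self _ _⟩
          · rw [if_neg hw'W]; exact ⟨fun h => absurd (hW'sub h) hwE', fun h => absurd h hw'W⟩
        have hw'W : w' ∈ W ↔ w' ∈ W' := memW w' hww'
        have hfe : f ≠ e := by
          rintro rfl
          have same : ∀ v ∈ xpair I f, (v ∈ W ↔ w' ∈ W') := by
            intro v hv
            rcases hpair v hv with rfl | rfl
            · exact hwW
            · exact hw'W
          have s0 := same _ ((mem_xpair I).2 (Or.inl rfl))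
          have s1 := same _ ((mem_xpair I).2 (Or.inr rfl))
          rcases hcr with ⟨h0, h1⟩ | ⟨h0, h1⟩
          · exact h1 (s1.2 (s0.1 h0))
          · exact h0 (s0.2 (s1.1 h1))
        have hfw : ∀ s : Fin 4, s = 0 ∨ s = 1 → I.vars f s ≠ w := by
          rintro s hs h
          apply hfe
          refine huniq f hf ((mem_xpair I).2 ?_)
          rcases hs with rfl | rfl
          · exact Or.inl h.symm
          · exact Or.inr h.symm
        refine ⟨f, mem_erase.2 ⟨hfe, hf⟩, ?_⟩
        have m0 := memW _ (hfw 0 (Or.inl rfl))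
        have m1 := memW _ (hfw 1 (Or.inr rfl))
        rcases hcr with ⟨h0, h1⟩ | ⟨h0, h1⟩
        · exact Or.inl ⟨m0.1 h0, fun h => h1 (m1.2 h)⟩
        · exact Or.inr ⟨fun h => h0 (m0.2 h), m1.1 h1⟩
      -- recurse
      have hlt : E'.card < k := by rw [← hk]; exact card_erase_lt_of_mem he
      have ih' := ih E'.card hlt E' rfl hconn' ⟨S, fun s hs => mem_erase.2 ⟨fun h => heS (h ▸ hs), hSE hs⟩, hSne, hSL⟩
      have hcardE : E'.card + 1 = E.card := card_erase_add_one he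
      calc (xverts I E).card ≤ (insert w (xverts I E')).card := card_le_card hV
        _ ≤ (xverts I E').card + 1 := card_insert_le _ _
        _ ≤ E'.card + 1 := by omega
        _ = E.card := hcardE
    · -- no leaf: every vertex has slot-degree at least two; handshake
      push Not at hleaf
      have h2 : ∀ w ∈ xverts I E, 2 ≤ xpdeg I E w := by
        intro w hw
        have := xpdeg_pos_of_mem_xverts I hI hw
        have := hleaf w hw
        omega
      have hsum : 2 * (xverts I E).card ≤ ∑ w, xpdeg I E w := by
        calc 2 * (xverts I E).card = ∑ w ∈ xverts I E, 2 := by rw [sum_const, smul_eq_mul, Nat.mul_comm]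
          _ ≤ ∑ w ∈ xverts I E, xpdeg I E w := sum_le_sum h2
          _ ≤ ∑ w, xpdeg I E w := sum_le_sum_of_subset_of_nonneg (subset_univ _) fun _ _ _ => Nat.zero_le _
      rw [sum_xpdeg] at hsum
      omega

/-! ## Inside the induction: the skeleton of an X-connected terminal core -/

variable {I : LocalMap 4 n m} {r : ℕ} {y : Fin m → Bool} {K : Finset (Fin m)} {w₁ w₂ : Finset (Fin n) × Finset (Fin m) × Bool}

/-- **The skeleton covers every XOR vertex of a terminal core** (`covered_of_terminal`). -/
theorem xverts_skel (hI : I.IsPure xorAndPred) (hT : Typed I) (hS : SimpleOverlap I) (hB : BoundaryExpanding r I)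
    (ht : Terminal I r y K w₁ w₂) : xverts I (skel I K (w₁.2.1 ∪ w₂.2.1)) = xverts I K := by
  refine Subset.antisymm (xverts_mono I (skel_subset I K _)) fun u hu => ?_
  obtain ⟨f, hf, huf, hnot⟩ := covered_of_terminal hI hT hS hB ht u hu
  exact (mem_xverts_iff I _ u).2 ⟨f, (mem_skel I).2 ⟨hf, hnot⟩, huf⟩

/-- **Inside the induction, the skeleton of an X-connected terminal core is X-connected** (on all XOR vertices of the core): a cut crossed by no
skeleton member is a clean cut, crossed once (`false_of_clean_bridge`) or twice (`false_of_cleanCut_two`) — both impossible. -/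
theorem xconnected_skel (hI : I.IsPure xorAndPred) (hT : Typed I) (hS : SimpleOverlap I) (hB : BoundaryExpanding r I)
    (ht : Terminal I r y K w₁ w₂)
    (hIH : ∀ c ∈ K, ∀ K₀ ⊆ K.erase c, ∀ d d' : Finset (Fin n) × Finset (Fin m) × Bool, Terminal I r y K₀ d d' → K₀.card ≤ 5)
    (hconn : XConnected I K) : XConnected I (skel I K (w₁.2.1 ∪ w₂.2.1)) := by
  intro W hWsub hWne hWneq
  rw [xverts_skel hI hT hS hB ht] at hWsub hWneq
  obtain ⟨f, hf, hcr⟩ := hconn W hWsub hWne hWneq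
  by_contra hno
  push Not at hno
  have hcut : CleanCut I K (w₁.2.1 ∪ w₂.2.1) W := by
    intro g hg hcg
    by_contra hng
    exact hno g ((mem_skel I).2 ⟨hg, hng⟩) hcg
  obtain ⟨hch, hO⟩ := hcut f hf hcr
  obtain ⟨f', hf', hne, hcr'⟩ := not_unique_crossing hI hT hS hB ht W hf hcr hch hO
  exact false_of_cleanCut_two hI hT hS hB ht hIH hcut hf hf' hne.symm hcr hcr'

/-- **`#xverts K ≤ #skeleton`** for an X-connected terminal core with a centre, inside the induction. -/
theorem card_xverts_le_card_skel (hI : I.IsPure xorAndPred) (hT : Typed I) (hS : SimpleOverlap I) (hB : BoundaryExpanding r I)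
    (ht : Terminal I r y K w₁ w₂)
    (hIH : ∀ c ∈ K, ∀ K₀ ⊆ K.erase c, ∀ d d' : Finset (Fin n) × Finset (Fin m) × Bool, Terminal I r y K₀ d d' → K₀.card ≤ 5)
    (hconn : XConnected I K) (hcentre : ∃ S ⊆ K, S.Nonempty ∧ (∀ w ∈ xverts I S, 2 ≤ xpdeg I S w) ∧ ∀ f ∈ S, ¬ IsChord I K f) :
    (xverts I K).card ≤ (skel I K (w₁.2.1 ∪ w₂.2.1)).card := by
  obtain ⟨S, hSK, hne, hL, hnc⟩ := hcentre
  rw [← xverts_skel hI hT hS hB ht]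
  exact card_xverts_le_card I hI _ (xconnected_skel hI hT hS hB ht hIH hconn)
    ⟨S, fun f hf => (mem_skel I).2 ⟨hSK hf, fun h => hnc f hf h.1⟩, hne, hL⟩

/-- **THE VERTEX BOUND** (all core sizes, inside the induction): an X-connected terminal core with a centre satisfies
`#xverts K + 3·#K ≤ #sharedSlots K + 2·#bdry K` — the skeleton is non-chords (`≤ #sharedSlots`) plus dirty chords (`≤` the boundary slack
`2·#bdry − 3·#K`).  At the tight twelve-slot structures: `u ≤ k − 6`, i.e. `#dirty ≥ u − 6`. -/
theorem card_xverts_add_le (hI : I.IsPure xorAndPred) (hT : Typed I) (hS : SimpleOverlap I) (hB : BoundaryExpanding r I)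
    (ht : Terminal I r y K w₁ w₂)
    (hIH : ∀ c ∈ K, ∀ K₀ ⊆ K.erase c, ∀ d d' : Finset (Fin n) × Finset (Fin m) × Bool, Terminal I r y K₀ d d' → K₀.card ≤ 5)
    (hconn : XConnected I K) (hcentre : ∃ S ⊆ K, S.Nonempty ∧ (∀ w ∈ xverts I S, 2 ≤ xpdeg I S w) ∧ ∀ f ∈ S, ¬ IsChord I K f) :
    (xverts I K).card + 3 * K.card ≤ (sharedSlots I K).card + 2 * (bdry I K).card := by
  classical
  have hle := card_xverts_le_card_skel hI hT hS hB ht hIH hconn hcentre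
  -- skeleton = non-chords + dirty chords
  set 𝒟 := K.filter fun c => IsChord I K c ∧ ¬ OutsideGated I K (w₁.2.1 ∪ w₂.2.1) c with h𝒟
  have hsplit : skel I K (w₁.2.1 ∪ w₂.2.1) ⊆ nonchords I K ∪ 𝒟 := by
    intro f hf
    obtain ⟨hfK, hnot⟩ := (mem_skel I).1 hf
    by_cases hch : IsChord I K f
    · exact mem_union_right _ (mem_filter.2 ⟨hfK, hch, fun hO => hnot ⟨hch, hO⟩⟩)
    · exact mem_union_left _ ((mem_nonchords I).2 ⟨hfK, hch⟩)
  have hexp : 3 * K.card ≤ 2 * (bdry I K).card := hB K ht.2.2.1.le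
  have hD : 𝒟.card ≤ 2 * (bdry I K).card - 3 * K.card :=
    card_dirty_le_slack hB ht (t := 2 * (bdry I K).card - 3 * K.card) (by omega) (filter_subset _ K)
      (fun c hc => (mem_filter.1 hc).2.1) (fun c hc => (mem_filter.1 hc).2.2)
  have hN := card_nonchords_le_card_sharedSlots I K
  have := (card_le_card hsplit).trans (card_union_le _ _)
  omega

end Summit.PneNP.PneNP.Theorems.PstarSkeletonSpan
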